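import Literature.Probability.LatticeModels.OnsagerYang
import Literature.Probability.LatticeModels.KramersWannierDuality
import Literature.Probability.LatticeModels.PlusFreeComparison
import Literature.Probability.LatticeModels.MessagerMiracleSoleFree
import Literature.Probability.LatticeModels.MeanFieldBound
import HarnessLib

/-!
# The Onsager–Yang magnetisation: the duality step, the critical point, and the final reduction

Topic `Probability/LatticeModels`, namespace `Literature.Probability.LatticeModels`. Sibling proof
file of `OnsagerYang.lean` (the Benettin–Gallavotti–Jona-Lasinio–Stella route to the named fact
`Literature.Probability.LatticeModels.onsager_yang` of `PlanarIsing.lean`, **crit-ising.S16**) and of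
`KramersWannierDuality.lean` (whose module docstring announces the present file). References below:

* G. Benettin, G. Gallavotti, G. Jona-Lasinio, A. L. Stella, *On the Onsager–Yang value of the
  spontaneous magnetization*, Comm. Math. Phys. **30** (1973) 45–54 ("BGJS"; §3, inputs a)–d),
  eqs. (3.1)–(3.10));
* J. L. Lebowitz, *Bounds on the correlations and analyticity properties of ferromagnetic Ising
  spin systems*, Comm. Math. Phys. **28** (1972) 313–321 (BGJS's reference [6] for their c):
  "the Onsager critical temperature `β_c` coincides with the 'true' critical temperature");
* T. T. Wu, *Theory of Toeplitz determinants and the spin correlations of the two-dimensional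
  Ising model. I*, Phys. Rev. **149** (1966) 380–401, as recorded in P. Deift, A. Its,
  I. Krasovsky, *Toeplitz matrices and Toeplitz determinants under the impetus of the Ising
  model*, Comm. Pure Appl. Math. **66** (2013) 1360–1438 ("DIK"), §5, eq. (64) and Remark 6.

## What `OnsagerYang.lean` left open, and what is done here

`OnsagerYang.onsager_yang_of_exactSolution_duality` reduces `onsager_yang` to four named facts:
the exact solution on the torus — `tendsto_torusRowPair_exists` (BGJS (3.3)) and
`torusRowPairLimit_tendsto_onsagerYang_sq` (BGJS (3.4), Montroll–Potts–Ward) —, BGJS's duality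
identity `twoPointFree_eq_twoPointPlus_of_criticalBetaTwo_lt` (BGJS (3.10)) and the critical
point `criticalBeta_two` (BGJS c)). This file proves, sorry-free:

1. **BGJS (3.10) from the tree's Kramers–Wannier duality** (`KramersWannierDuality`: BGJS
   (2.3)–(2.4), discharged there) **and the Lebowitz–Martin-Löf criterion**
   (`PlusFreeComparison.freeCorr_eq_plusCorr_of_spontaneousMagnetization_eq_zero`): for `β > 0`
   with `m*(β*) = 0`, `⟨σ₀σ_x⟩^∅_β = ⟨σ₀σ_x⟩⁺_β`
   (`twoPointFree_eq_twoPointPlus_of_spontaneousMagnetization_dualBeta_eq_zero`) — exactly BGJS's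
   proof of (3.10): both sides are, by (2.3) and (2.4), the plus resp. free expectation at the
   dual temperature `β* < β_c` of the same disorder observable, a spin polynomial, and below `β_c`
   the free and plus states coincide (their input d), Lebowitz–Martin-Löf 1972). Hence
   `twoPointFree_eq_twoPointPlus_of_criticalBetaTwo_lt` follows from the *subcritical half of
   c)*: `m*(β) = 0` for `0 ≤ β < β_c(2)` (`twoPointFree_eq_twoPointPlus_of_subcritical`).
2. **BGJS c) is not an independent input above `β_c`**: granting the exact solution
   ((3.3)–(3.4)) and the subcritical half of c), `m*(β) = m_O(β) > 0` for `β > β_c(2)`, and then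
   `criticalBeta_two` itself follows (`criticalBeta_two_of_exactSolution_of_subcritical`), as does
   `onsager_yang` (`onsager_yang_of_exactSolution_of_subcritical`).
3. **The subcritical half of c) by Lebowitz's mechanism** (Lebowitz 1972, §III, as BGJS use
   it; DIK Remark 6: "`M_ph = 0` for `T > T_c` … follows, a posteriori, from a proof that
   `lim D_n(φ) = 0`"): from the exponential decay of the *periodic* row two-point function above
   `T_c` — the exact-solution input `torusRowPairLimit_exp_decay_of_lt_criticalBetaTwo` (Wu 1966;
   DIK eq. (64)), the only new named fact of this file — the GKS sandwich
   `⟨σσ⟩^∅ ≤ (σσ)_p` (BGJS (3.7), `OnsagerYang.torusRowPairLimit_sandwich_of_exists`), the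
   Messager–Miracle-Solé domination of every direction by the axis
   (`MessagerMiracleSoleFree.twoPointFree_le_axis_of_mem_sphere_holds`) and the tree's
   "exponential decay of `⟨σ₀σ_x⟩^∅` forces `m* = 0`"
   (`PlusFreeComparison.spontaneousMagnetization_eq_zero_of_twoPointFree_exp_decay`, the GHS
   boundary-field bound), one gets `m*(β) = 0` for `0 ≤ β < β_c(2)`
   (`spontaneousMagnetization_two_eq_zero_of_lt_criticalBetaTwo_of_exactSolution`).
4. **Final reduction** (`onsager_yang_of_exactSolution`, `criticalBeta_two_of_exactSolution`):
   `onsager_yang` — and with it `criticalBeta_two` (**crit-ising.S15**) — follow from three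
   statements about ONE object, the iterated torus limit `(σ_{(0,0)}σ_{(k,0)})_p(β)` of
   `OnsagerYang.torusRowPairLimit`, all three parts of the exact solution of the square-lattice
   Ising model on the torus (transfer matrix / Pfaffians, Toeplitz determinants, Szegő's theorem):
   existence of the limits (BGJS (3.3)), the Montroll–Potts–Ward long-range order
   `→ (1 − sinh(2β)^{-4})^{1/4}` for `β > β_c` (BGJS (3.4)), and exponential decay for
   `0 < β < β_c` (Wu 1966). Everything else in BGJS's paper (GKS, clustering of the plus state,
   Kramers–Wannier duality with boundary conditions, the Lebowitz–Martin-Löf criterion,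
   Lebowitz's `β₀ = β_c`) is now a theorem of the tree.

## Faithfulness notes

* The new named fact records Wu's asymptotics `⟨σ_{0,0}σ_{0,N}⟩ ≃ c(β) N^{-1/2} γ₂^{-N}`
  (`γ₂ = z*/z > 1` for `T > T_c`, `z = tanh β`, `z* = (1−z)/(1+z)`; DIK eqs. (22), (26), (64))
  only through its consequence "`≤ C e^{-ck}` for some `C` and some `c > 0`", which is weaker than
  the printed statement; the two-point function there is the Toeplitz determinant
  `D_N(φ_Onsager)` of Potts–Ward / Montroll–Potts–Ward (DIK eq. (50)), i.e. the correlation of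
  the periodic lattice in the thermodynamic limit, here `torusRowPairLimit` exactly as in
  `torusRowPairLimit_tendsto_onsagerYang_sq` (BGJS (3.3)–(3.4) use the same object).
* No statement of `PlanarIsing.lean` or `OnsagerYang.lean` is modified; `onsager_yang` is not
  weakened: the final theorems have it verbatim as conclusion.

## Mathlib / tree anchors

`SimpleGraph.Walk.bypass`, `SimpleGraph.Walk.bypass_isPath` (a path from a walk),
`zdGraph_reachable` (`LatticeGraph`), `kw_free_plus_holds`, `kw_plus_free_holds`,
`freeExpect_eq_plusExpect_of_corr_eq`, `kwDisorder_isSpinPolynomial`, `dualBeta_pos`,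
`dualBeta_lt_criticalBetaTwo` (`KramersWannierDuality`), `sphere`, `mem_sphere`,
`Site.norm_eq_supNorm` (`SharpnessProofs`), `spontaneousMagnetization_zero` (`MeanFieldBound`).
-/

noncomputable section

open Filter Topology Finset Literature.Probability.LatticeModels

namespace Literature.Probability.LatticeModels

/-! ### Paths in `ℤ^d` -/

section Paths

variable {d : ℕ}

/-- Any two sites of `ℤ^d` are joined by a (self-avoiding) lattice path: `ℤ^d` is connected
(`zdGraph_reachable`) and a walk can be shortened to a path (`SimpleGraph.Walk.bypass`).
(BGJS §2: "`Γ` an arbitrary path connecting the two sites `x` and `y`".) [folklore] -/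
theorem exists_walk_isPath_zdGraph (x y : Site d) : ∃ p : (zdGraph d).Walk x y, p.IsPath := by
  classical
  obtain ⟨p⟩ := zdGraph_reachable x y
  exact ⟨p.bypass, p.bypass_isPath⟩

end Paths

/-! ### BGJS (3.10): the duality step -/

/-- **BGJS eq. (3.10), mechanism** (Benettin–Gallavotti–Jona-Lasinio–Stella, CMP 30 (1973), §3,
proof of (3.10) from (3.8)–(3.9) = (2.3)–(2.4) and input d)): for `β > 0`, if the spontaneous
magnetisation vanishes at the dual temperature `β*` (so that, by the Lebowitz–Martin-Löf
criterion, the free and plus states coincide at `β*` — boundary-condition independence, BGJS d)),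
then `⟨σ₀σ_x⟩^∅_{β,0} = ⟨σ₀σ_x⟩⁺_{β,0}` for every `x`. Proof: choose a lattice path `Γ` from `0` to
`x`; by Kramers–Wannier duality (2.3) the left side is `⟨D_Γ⟩⁺_{β*}` and by (2.4) the right side is
`⟨D_Γ⟩^∅_{β*}`, where the disorder observable `D_Γ = ∏_{b∈Γ}(cosh 2β* − σ_{b*} sinh 2β*)` is a spin
polynomial, on which the two states at `β*` agree. [cite: BenettinGallavottiJonaLasinioStella1973, §3, eq. (3.10) (proof via (2.3)–(2.4) and d))] -/
theorem twoPointFree_eq_twoPointPlus_of_spontaneousMagnetization_dualBeta_eq_zero {β : ℝ}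
    (hβ : 0 < β) (hm : spontaneousMagnetization 2 (dualBeta β) = 0) (x : Site 2) :
    twoPointFree 2 β x = twoPointPlus 2 β x := by
  classical
  obtain ⟨p, hp⟩ := exists_walk_isPath_zdGraph (0 : Site 2) x
  rw [kw_free_plus_holds hβ x p hp, kw_plus_free_holds hβ x p hp]
  exact (freeExpect_eq_plusExpect_of_corr_eq (dualBeta_pos hβ).le
    (fun A => freeCorr_eq_plusCorr_of_spontaneousMagnetization_eq_zero (dualBeta_pos hβ).le hm A)
    (kwDisorder_isSpinPolynomial (dualBeta β) p.edges)).symm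

/-- **BGJS eq. (3.10) from the subcritical half of BGJS c)** ("`⟨σ_xσ_y⟩_a(β) = ⟨σ_xσ_y⟩_+(β)`,
`β > β_c`"; Benettin–Gallavotti–Jona-Lasinio–Stella, CMP 30 (1973), §3): if `m*(β') = 0` for all
`0 ≤ β' < β_c(2)` (Lebowitz 1972: `β₀ = β_c`), then, since `β > β_c(2)` forces `0 < β* < β_c(2)`
(`dualBeta_lt_criticalBetaTwo`), the named fact
`twoPointFree_eq_twoPointPlus_of_criticalBetaTwo_lt` of `OnsagerYang.lean` holds. [cite: BenettinGallavottiJonaLasinioStella1973, §3, eq. (3.10)] -/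
theorem twoPointFree_eq_twoPointPlus_of_subcritical
    (hsub : ∀ ⦃β : ℝ⦄, 0 ≤ β → β < criticalBetaTwo → spontaneousMagnetization 2 β = 0) :
    twoPointFree_eq_twoPointPlus_of_criticalBetaTwo_lt := by
  intro β hβ x
  have hβ0 : 0 < β := criticalBetaTwo_pos.trans hβ
  exact twoPointFree_eq_twoPointPlus_of_spontaneousMagnetization_dualBeta_eq_zero hβ0
    (hsub (dualBeta_pos hβ0).le (dualBeta_lt_criticalBetaTwo hβ)) x

/-! ### Above `β_c`: the exact solution and the subcritical half of c) give `m* = m_O > 0` -/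

/-- **BGJS §3, `β > β_c`, with (3.10) supplied by duality**: granting the exact solution on the
torus (existence of the periodic limits (3.3), `tendsto_torusRowPair_exists`, and the
Montroll–Potts–Ward long-range order (3.4), `torusRowPairLimit_tendsto_onsagerYang_sq`) and the
subcritical half of c) (`m* = 0` on `[0, β_c(2))`), one has `m*(β) = m_O(β)` for every
`β > β_c(2)`: the sandwich (3.7) and the clustering (1.5) are theorems of `OnsagerYang.lean`, and
(3.10) is `twoPointFree_eq_twoPointPlus_of_subcritical`. [cite: BenettinGallavottiJonaLasinioStella1973, §3, after eq. (3.10)] -/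
theorem spontaneousMagnetization_two_eq_onsagerYang_of_gt_of_subcritical
    (hex : tendsto_torusRowPair_exists) (hMPW : torusRowPairLimit_tendsto_onsagerYang_sq)
    (hsub : ∀ ⦃β : ℝ⦄, 0 ≤ β → β < criticalBetaTwo → spontaneousMagnetization 2 β = 0)
    {β : ℝ} (hβ : criticalBetaTwo < β) :
    spontaneousMagnetization 2 β = onsagerYangMagnetization β :=
  spontaneousMagnetization_two_eq_onsagerYang_of_gt
    (twoPointPlus_row_tendsto_onsagerYang_sq_of_periodic hMPW
      (torusRowPairLimit_sandwich_of_exists hex) (twoPointFree_eq_twoPointPlus_of_subcritical hsub))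
    twoPointPlus_tendsto_spontaneousMagnetization_sq_holds spontaneousMagnetization_nonneg_holds hβ

/-- **`onsager_yang` from the exact solution and the subcritical half of BGJS c)**: the three
cases of `onsager_yang_of_parts` are `β > β_c(2)` (previous theorem), `0 ≤ β < β_c(2)` (the
hypothesis) and `β = β_c(2)` (right-continuity of `m*`, `plusCorr_rightContinuous_holds`, with
`m_O(β) → 0` as `β ↓ β_c`). (BGJS: "`m(β) = m_O(β) ∀β`".) [cite: BenettinGallavottiJonaLasinioStella1973, §3 (main result)] -/
theorem onsager_yang_of_exactSolution_of_subcritical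
    (hex : tendsto_torusRowPair_exists) (hMPW : torusRowPairLimit_tendsto_onsagerYang_sq)
    (hsub : ∀ ⦃β : ℝ⦄, 0 ≤ β → β < criticalBetaTwo → spontaneousMagnetization 2 β = 0) :
    onsager_yang :=
  have hgt : ∀ ⦃β : ℝ⦄, criticalBetaTwo < β →
      spontaneousMagnetization 2 β = onsagerYangMagnetization β :=
    fun _ hβ => spontaneousMagnetization_two_eq_onsagerYang_of_gt_of_subcritical hex hMPW hsub hβ
  onsager_yang_of_parts hgt hsub
    (spontaneousMagnetization_two_criticalBetaTwo_eq_zero_of hgt plusCorr_rightContinuous_holds)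

/-- **BGJS c) recovered** ("the Onsager critical temperature `β_c` coincides with the 'true'
critical temperature", Benettin–Gallavotti–Jona-Lasinio–Stella, CMP 30 (1973), §3 c); Lebowitz,
CMP 28 (1972), §III): granting the exact solution on the torus and only the *subcritical* half
`m* = 0` on `[0, β_c(2))`, the full identification `criticalBeta 2 = criticalBetaTwo`
(`criticalBeta_two` of `PlanarIsing.lean`, **crit-ising.S15**) follows, because above `β_c(2)` the
magnetisation equals `m_O(β) > 0` (`criticalBeta_two_of_onsager_yang`). [cite: BenettinGallavottiJonaLasinioStella1973, §3 c)] -/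
theorem criticalBeta_two_of_exactSolution_of_subcritical
    (hex : tendsto_torusRowPair_exists) (hMPW : torusRowPairLimit_tendsto_onsagerYang_sq)
    (hsub : ∀ ⦃β : ℝ⦄, 0 ≤ β → β < criticalBetaTwo → spontaneousMagnetization 2 β = 0) :
    criticalBeta_two :=
  criticalBeta_two_of_onsager_yang (onsager_yang_of_exactSolution_of_subcritical hex hMPW hsub)

/-! ### Below `β_c`: Lebowitz's `β₀ = β_c` from the decay of the periodic two-point function -/

/-- **Exact solution above `T_c`: exponential decay of the periodic row two-point function**
(J. L. Lebowitz, CMP 28 (1972) 313, §III, eq. (3.3): "`lim_Λ ⟨σ_iσ_j⟩(β, h = 0; Λ, b_p) ≤ K exp[−κ r_ij]`,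
`K < ∞`, `κ > 0`" with `b_p` = periodic (including cylindrical) boundary conditions; p. 319: "An
inequality of the form (3.3) can be established for the two dimensional square lattice with nearest
neighbor interactions for `β < β_O`, `β_O` is the (reciprocal) Onsager temperature defined by the
relation `sinh(2β_O J₁) sinh(2β_O J₂) = 1` … The bound (3.3) is a direct consequence of the
expression for `⟨σ_iσ_j⟩` in terms of the eigenvalues and eigenvectors of the transfer matrix
[3,12,13] … for 'arbitrary' directions use has to be made of the 'symmetry' of the eigenvectors
of the transfer matrix (M. E. Fisher, private communication)" — [12] = Onsager 1944,
[13] = Kaufman–Onsager 1949. In the tree's object the two sites lie in ONE transfer slice of the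
cylinder (the inner limit `M → ∞` of `IsingTorusTransfer` runs along the transfer direction, the
sites are `k` apart along the ring), i.e. this is the in-row correlation of Kaufman–Onsager /
Montroll–Potts–Ward, `⟨σ_{0,0}σ_{0,N}⟩ = D_N(φ_Onsager)` in the limit `N → ∞` of the width
(Deift–Its–Krasovsky, CPAM 66 (2013), §4, eq. (50)) — NOT Lebowitz's "immediate" axial case —, whose
precise asymptotics above `T_c`, `≃ c(β) N^{-1/2} γ₂^{-N}` with `γ₂ = z*/z > 1`, `z = tanh β`,
`z* = (1−z)/(1+z)`, is T. T. Wu, Phys. Rev. 149 (1966) 380, recorded in Deift–Its–Krasovsky, §5,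
eq. (64), with eqs. (22), (26), (50)). This is the exact-solution input of Lebowitz's `β_O = β_c`
(ibid. p. 320), which is BGJS's input c) below `β_c`. Vendored in the ROW case only (the other
directions are supplied below by the Messager–Miracle-Solé inequality instead of the symmetry of
the eigenvectors) and for the iterated torus limit `(σ_{(0,0)}σ_{(k,0)})_p(β) = lim_N lim_M` of
`OnsagerYang.torusRowPairLimit` (BGJS (3.3), the same object as in
`torusRowPairLimit_tendsto_onsagerYang_sq`): for the nearest-neighbour Ising model on `ℤ²`
(`J₁ = J₂ = 1`, `β_O = β_c(2) = ½ log(1+√2)`) and `0 < β < β_c(2)` there are `K` and `κ > 0` with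
`(σ_{(0,0)}σ_{(k,0)})_p(β) ≤ K e^{-κk}` for all `k`. [cite: Wu1966, T > T_c asymptotics of the in-row correlation D_N(φ_Onsager) (= DeiftItsKrasovsky2013, §5, eq. (64) with §4, eq. (50))] [cite: Lebowitz1972, §III, eq. (3.3) and pp. 319–320 (periodic/cylindrical b.c., β < β_O, arbitrary directions)] -/
def torusRowPairLimit_exp_decay_of_lt_criticalBetaTwo : Prop :=
  ∀ ⦃β : ℝ⦄, 0 < β → β < criticalBetaTwo →
    ∃ C c : ℝ, 0 < c ∧ ∀ k : ℕ, torusRowPairLimit β k ≤ C * Real.exp (-c * k)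

/-- In `ℤ²`, the axis site `n e₁` of `MessagerMiracleSoleFree` is the row site `(n, 0)` of
`OnsagerYang`. [folklore] -/
theorem single_zero_eq_vec (n : ℤ) : (Pi.single (0 : Fin 2) n : Site 2) = ![n, 0] := by
  funext i
  fin_cases i <;> simp

/-- **BGJS (3.7), first inequality, with the decay input**: granting the existence of the periodic
limits (3.3) and the decay of the periodic row two-point function above `T_c`, the free row
two-point function decays exponentially, `⟨σ₀σ_{(k,0)}⟩^∅_{β,0} ≤ C e^{-ck}`, for `0 < β < β_c(2)`
(GKS: `⟨σσ⟩^∅ ≤ (σσ)_p`, `torusRowPairLimit_sandwich_of_exists`). [cite: BenettinGallavottiJonaLasinioStella1973, eq. (3.7)] -/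
theorem twoPointFree_row_exp_decay_of_exactSolution (hex : tendsto_torusRowPair_exists)
    (hdec : torusRowPairLimit_exp_decay_of_lt_criticalBetaTwo) {β : ℝ} (hβ0 : 0 < β)
    (hβ : β < criticalBetaTwo) :
    ∃ C c : ℝ, 0 < c ∧ ∀ k : ℕ, twoPointFree 2 β ![(k : ℤ), 0] ≤ C * Real.exp (-c * k) := by
  obtain ⟨C, c, hc, hk⟩ := hdec hβ0 hβ
  exact ⟨C, c, hc, fun k =>
    ((torusRowPairLimit_sandwich_of_exists hex hβ0.le k).1).trans (hk k)⟩

/-- **From the axis to every direction** (Messager–Miracle-Solé 1977; Hegerfeldt 1977; the tree's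
`twoPointFree_le_axis_of_mem_sphere_holds`: `⟨σ₀σ_y⟩^∅ ≤ ⟨σ₀σ_{‖y‖_∞ e₁}⟩^∅`): exponential decay of
the free two-point function along the first axis of `ℤ²` propagates to all of `ℤ²` in the sup
norm, with the same rate and the constant `max C 1` (the origin contributes `⟨σ₀σ₀⟩ = 1`). [cite: MessagerMiracleSoleJSP1977, main theorem (monotonicity of ⟨σ₀σ_x⟩ under reflections)] -/
theorem twoPointFree_exp_decay_of_row {β : ℝ} (hβ : 0 ≤ β) {C c : ℝ}
    (hrow : ∀ k : ℕ, twoPointFree 2 β ![(k : ℤ), 0] ≤ C * Real.exp (-c * k)) (x : Site 2) :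
    twoPointFree 2 β x ≤ max C 1 * Real.exp (-c * ‖x‖) := by
  rw [Site.norm_eq_supNorm]
  rcases Nat.eq_zero_or_pos (Site.supNorm x) with h0 | hpos
  · have hx : x = 0 := Site.supNorm_eq_zero_iff.1 h0
    rw [h0, hx, twoPointFree_zero]
    simp
  · have h1 := twoPointFree_le_axis_of_mem_sphere_holds (d := 2) hβ (by norm_num) (Site.supNorm x)
      hpos x (self_mem_sphere x)
    have h2 : (Pi.single (⟨0, by norm_num⟩ : Fin 2) ((Site.supNorm x : ℕ) : ℤ) : Site 2) =
        ![((Site.supNorm x : ℕ) : ℤ), 0] := single_zero_eq_vec _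
    rw [h2] at h1
    refine h1.trans ((hrow (Site.supNorm x)).trans ?_)
    exact mul_le_mul_of_nonneg_right (le_max_left C 1) (Real.exp_nonneg _)

/-- **The subcritical half of BGJS c), by Lebowitz's mechanism** (Lebowitz, CMP 28 (1972), §III:
`β₀ = β_c` for the square lattice, i.e. `m*(β) = 0` for `β < β_c`, from the decay of the exactly
known two-point function; Deift–Its–Krasovsky 2013, Remark 6). Granting the exact solution on the
torus — existence of the periodic limits (BGJS (3.3)) and Wu's decay above `T_c`
(`torusRowPairLimit_exp_decay_of_lt_criticalBetaTwo`) —: for `0 ≤ β < β_c(2)`, `m*(β) = 0`.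
Proof: `⟨σσ⟩^∅ ≤ (σσ)_p` decays exponentially along the axis (GKS sandwich), hence in every
direction (Messager–Miracle-Solé), hence `m* = 0` by the GHS boundary-field bound
(`spontaneousMagnetization_eq_zero_of_twoPointFree_exp_decay`); at `β = 0` directly
(`spontaneousMagnetization_zero`). [cite: Lebowitz1972, §III (β₀ = β_c for the two-dimensional square lattice)] -/
theorem spontaneousMagnetization_two_eq_zero_of_lt_criticalBetaTwo_of_exactSolution
    (hex : tendsto_torusRowPair_exists) (hdec : torusRowPairLimit_exp_decay_of_lt_criticalBetaTwo)
    ⦃β : ℝ⦄ (hβ0 : 0 ≤ β) (hβ : β < criticalBetaTwo) : spontaneousMagnetization 2 β = 0 := by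
  rcases hβ0.eq_or_lt with h0 | hpos
  · rw [← h0]
    exact spontaneousMagnetization_zero 2
  · obtain ⟨C, c, hc, hrow⟩ := twoPointFree_row_exp_decay_of_exactSolution hex hdec hpos hβ
    exact spontaneousMagnetization_eq_zero_of_twoPointFree_exp_decay hβ0 hc
      (twoPointFree_exp_decay_of_row hβ0 hrow)

/-! ### The final reduction: `onsager_yang` from the exact solution on the torus alone -/

/-- **`criticalBeta_two` (crit-ising.S15: `β_c(2) = ½ log(1+√2)`) from the exact solution on the
torus**: existence of the periodic row limits (BGJS (3.3)), the Montroll–Potts–Ward long-range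
order above `β_c` (BGJS (3.4)) and Wu's exponential decay below `β_c` imply
`criticalBeta 2 = criticalBetaTwo` — BGJS's c) (Lebowitz 1972, §III: "`β₀ = β_c` for this
system") with every soft step formalised. [cite: Lebowitz1972, §III] -/
theorem criticalBeta_two_of_exactSolution
    (hex : tendsto_torusRowPair_exists) (hMPW : torusRowPairLimit_tendsto_onsagerYang_sq)
    (hdec : torusRowPairLimit_exp_decay_of_lt_criticalBetaTwo) : criticalBeta_two :=
  criticalBeta_two_of_exactSolution_of_subcritical hex hMPW
    (spontaneousMagnetization_two_eq_zero_of_lt_criticalBetaTwo_of_exactSolution hex hdec)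

/-- **`onsager_yang` from the exact solution on the torus** (Benettin–Gallavotti–Jona-Lasinio–
Stella, CMP 30 (1973), §3, with all of their soft inputs a), c), d), (1.5), (3.6)–(3.10) now
theorems of the tree): the Onsager–Yang formula `m*(β) = (1 − sinh(2β)^{-4})^{1/8}` for
`β > β_c(2)`, `m*(β) = 0` for `0 ≤ β ≤ β_c(2)`, follows from three statements about the iterated
torus limit `(σ_{(0,0)}σ_{(k,0)})_p(β)` of the row two-point function: the limits exist (BGJS
(3.3)), they tend to `m_O(β)²` as `k → ∞` for `β > β_c(2)` (BGJS (3.4), Montroll–Potts–Ward 1963),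
and they decay exponentially in `k` for `0 < β < β_c(2)` (Wu 1966). [cite: BenettinGallavottiJonaLasinioStella1973, §3 (main result)] -/
theorem onsager_yang_of_exactSolution
    (hex : tendsto_torusRowPair_exists) (hMPW : torusRowPairLimit_tendsto_onsagerYang_sq)
    (hdec : torusRowPairLimit_exp_decay_of_lt_criticalBetaTwo) : onsager_yang :=
  onsager_yang_of_exactSolution_of_subcritical hex hMPW
    (spontaneousMagnetization_two_eq_zero_of_lt_criticalBetaTwo_of_exactSolution hex hdec)

end Literature.Probability.LatticeModels
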